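import Literature.AnabelianGeometry.SemiGraphs.ArithThm54iCapstoneOuterAction
import Literature.AnabelianGeometry.SemiGraphs.ArithThm54iiCapstoneOuterAction
import Literature.AnabelianGeometry.SemiGraphs.ArithThm54iiBindersOuterAction
import Literature.AnabelianGeometry.SemiGraphs.ArithTowerLevelStabilityJunction
import Literature.AnabelianGeometry.SemiGraphs.TemperedCosetTowerNoFixedBranchPairOfTower
import HarnessLib

/-!
# [SemiAnbd] Thm 5.4 (i) ∧ (ii) AT `π₁^temp(𝒢) ⋊^out Π_A` — the T54-B capstones with every LANDED producer
# bound by name (corollary-integrator; proof-only)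

Mochizuki, *Semi-graphs of anabelioids*, Publ. RIMS **42** (2006) 221–322, §5 Thm 5.4 (i)(ii), manuscript
p. 66 ("the proofs are entirely parallel to those of Theorem 3.7, Corollary 3.9"); Rmk 5.3.1 p. 65; Def 5.1 (i)
p. 62; Prop 3.6 (iv) p. 38 [cite: MochizukiSemiAnbd2006, Thm 5.4 (i), p. 66].

PROOF-ONLY file (abc-iut cell, layer L3, sub-DAG `plan/L3/SUBDAG-SemiAnbd-Thm54.md`, producer row T54-B =
`plan/GAP-LEDGER.md` G-w4d053-1; row «T54·COROLLARY-INTEGRATOR» of the L3 lead's α64, seat abc-iut-w4-d089 gen 6).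
No definition, no new named fact, no producer restated.  abc-iut-w4-d029's two CAPSTONES
`arithMaximalCompactStatementI_outerAction_piPresentation` (ArithThm54iCapstoneOuterAction.lean, p433251) and
`arithMaximalCompactStatementII_outerAction_piPresentation` (ArithThm54iiCapstoneOuterAction.lean, p433258)
state [SemiAnbd] Thm 5.4 (i)/(ii) for the decomposition data `D := decompositionDataOfChart Rc ι` PRODUCED from
the chart of Prop 3.6 inside the arithmetic tempered group `E := π₁^temp(𝒢) ⋊^out_{ρ'} Π_A`, modulo a list of
named residual binders.  Here the binders that are by now THEOREMS of the tree are bound BY NAME at the call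
site, in ONE corollary `arithMaximalCompactStatement_outerAction_piPresentation_of_producers : … → (i) ∧ (ii)`:

* `hKst` (Φ-stability of the tree levels `ker ρ_n`) := abc-iut-L3-t9's
  `GaloisLevelData.hKst_of_hLst_outerAction` (E1 junction, ArithTowerLevelStabilityJunction.lean) from `hLst`;
* `hnobpNCpt` (no compact `C ≠ 1` of `π₁^temp(𝒢)` fixes a compatible vertex-with-two-branches system of the
  finite coset levels) := abc-iut-w4-d083's UNCONDITIONAL `hnobpNCpt_cosetTower_holds`
  (TemperedCosetTowerNoFixedBranchPairOfTower.lean; (I0v) = abc-iut-L3-t6's `galoisLevelData_faithfulV`);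
* `hR` (Rmk 5.3.1, first sentence: verticial / edge-like subgroups compact and arithmetically ample) :=
  abc-iut-w4-d040's `verticialEdgeLikeCompactAmple_outerAction_cosetTowerC` (ArithThm54iiBindersOuterAction.lean,
  p432297) AT THE CAPSTONES' OWN PACKAGE (`K n := ker ρ_n`, `L n := ker π_n`, the tower inputs
  `piPresentation_hT/hHK/hMK/hlift/hliftE/hfree`, `finite_quotient_ker_piLevelAut`, `ker_projAut_anti`,
  `ker_piLevelAut_anti`, `ker_projAut_le_ker_piLevelAut`, `isOpen_ker_projAut` — the SAME names the capstones
  consume), its `hconjPair` already discharged there from `hBR`;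
* `hVE` (no verticial subgroup is edge-like) := abc-iut-w4-d040/abc-iut-w4-d064's
  `not_isEdgeLike_of_isVerticial_outerAction_of_finite` (Thm 3.7 (iii) at the finite `𝔾` being
  `compactInVerticialAt_of_finiteGraph`).

HONEST RESIDUAL (the corollary's explicit binders, each with its owner on the cell's T54 binder board):
the Prop 3.6 (iv)-at-`ρ_𝔾(a)` / Def 5.1 (i)(c) design data `hV`, `hE`, `hopen`, `hBR` (abc-iut-w4-d082's
currency); the compatibility `hP` of the presentation with the outer action (producer: abc-iut-w4-d053's
`isArithCompatible_piPresentation_outerAction_of_branchPair_of_finite … hV hBR`, module not yet built — v2);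
the Φ-stability `hLst` of the finite levels (abc-iut-w4-d048 (J2) / abc-iut-L3-t9 characteristic tower); the
LEVEL-B topology on `E` with open tree-level action kernels `hKopen`, `IsTempered E` (`hT`), abc-iut-L3-d2's
neighbourhood basis `hb` and `hK1′` (owner of the topology term: abc-iut-w6-d070's `arithLevelTopology`, olean
pending — v2); Thm 5.4's printed frame hypothesis `noSwitchBase` and its own hypotheses `hest`/`hbot`
(jointly inhabited with the design data: abc-iut-w6-d099 p433299); and (AI4″) `stabBranchPairAug`
(abc-iut-w4-d059's `map_aug_le_conj_of_levelDict`, behind the unbuilt `CompactOrbitLimit`; that is where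
abc-iut-w4-d085's `hcof_of_faithful_levels` and abc-iut-w6-d072's `hfaith_geom_cosetTower_of_tower` bind — v2).
`Π_A` compact and `E` Hausdorff are the standing frame of §5.  Nothing beyond composition is proved here;
typed ≠ proved for the residual inputs; this is Thm 5.4 for OUR tower decomposition; no side taken on
[IUTchIII] Cor. 3.12.
-/

namespace Literature.AnabelianGeometry.SemiGraphs

namespace ProfiniteSemiGraph

open CategoryTheory Topology Filter
open Literature.AnabelianGeometry.EtaleTheta
open scoped Pointwise

universe u

variable {𝒢 : ProfiniteSemiGraph.{u}}

/-- The edge subgroups of the presentation are edge-like (abc-iut-w4-d082's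
`piPresentation_M_mem_edgeLikeSubgroups`, ArithPiPresentationOuterCompat.lean p427209, restated PRIVATELY here —
exactly as in the two capstone files — only to decouple this module from that file's build; proof verbatim:
`M_ε` is the image of the edge homomorphism `decompHom ∘ (β ε)_*`, abc-iut-L3-t8 `isEdgeHom_comp_brHom`).
[cite: MochizukiSemiAnbd2006, Thm 3.7(iii) p.41] -/
private theorem piPresentation_M_mem_edgeLikeSubgroups'' (h36 : 𝒢.Prop36Hypotheses)
    (T : ∀ w : 𝒢.graph.Vertex, (𝒢.galoisLevelData h36).PointSeq h36.isCountable w)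
    (R : SemiGraph.RefBranches 𝒢.graph) (ε : 𝒢.graph.Edge) :
    ((𝒢.galoisLevelData h36).piPresentation h36.isCountable T R).M ε ∈
      edgeLikeSubgroups (𝒢.temperedPiChart h36) ε := by
  have hmem : ((𝒢.branchSubgroup (R.β ε) (R.ν ε) (R.abuts_β ε)).map (T (R.ν ε)).decompHom) ∈
      edgeLikeSubgroups (𝒢.temperedPiChart h36) (𝒢.graph.edgeOf (R.β ε)) :=
    ⟨(T (R.ν ε)).decompHomCont.comp (𝒢.brHom (R.β ε) (R.ν ε) (R.abuts_β ε)),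
      isEdgeHom_comp_brHom _ (R.abuts_β ε) (T (R.ν ε)).isVerticialHom_decompHomCont, by
        rw [branchSubgroup, MonoidHom.map_range]; rfl⟩
  rw [R.edgeOf_β] at hmem
  simpa only [GaloisLevelData.piPresentation_M] using hmem

/-- **[SemiAnbd] Thm 5.4 (i) ∧ (ii) at `π₁^temp(𝒢) ⋊^out Π_A` for the chart of Prop 3.6 — the two T54-B
capstones with every landed producer bound by name.**  For a finite graph `𝔾` under the hypotheses of
Thm 3.7, an outer action `ρ' : Π_A → Out π₁^temp(𝒢)` over a base action on `𝔾` with its Prop 3.6 (iv) /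
Def 5.1 (i)(c) data (`hV`, `hE`, `hopen`, `hBR`), a presentation compatible with the outer action (`hP`),
Φ-stable finite levels (`hLst`), the level-B topology on `E` (`hKopen`, `hT`, `hb`, `hK1′`), Thm 5.4's frame
`noSwitchBase` and hypotheses `hest`/`hbot`, and (AI4″) `stabBranchPairAug`: BOTH `ArithMaximalCompactStatementI`
and `ArithMaximalCompactStatementII` hold for the produced decomposition data — `hKst`, `hnobpNCpt`, `hR`, `hVE`
of the capstones being the theorems `GaloisLevelData.hKst_of_hLst_outerAction`, `hnobpNCpt_cosetTower_holds`,
`verticialEdgeLikeCompactAmple_outerAction_cosetTowerC`, `not_isEdgeLike_of_isVerticial_outerAction_of_finite`.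
[cite: MochizukiSemiAnbd2006, Thm 5.4 (i), p. 66] -/
theorem arithMaximalCompactStatement_outerAction_piPresentation_of_producers
    (h37 : 𝒢.Thm37Hypotheses) (hG : 𝒢.graph.IsGraph) [Finite 𝒢.graph.Vertex] [Finite 𝒢.graph.Branch]
    {PA : Type u} [Group PA] [TopologicalSpace PA] [IsTopologicalGroup PA] [CompactSpace PA]
    (ρ' : PA →* TopOut (𝒢.temperedPiChart h37.toProp36Hypotheses).G) (baseAct : PA →* Aut 𝒢.graph)
    [TopologicalSpace (outerSemidirectProduct ρ')] [IsTopologicalGroup (outerSemidirectProduct ρ')]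
    [T2Space (outerSemidirectProduct ρ')]
    (T : ∀ w : 𝒢.graph.Vertex, (𝒢.galoisLevelData h37.toProp36Hypotheses).PointSeq h37.toProp36Hypotheses.isCountable w) (R : SemiGraph.RefBranches 𝒢.graph)
    (Rc : ChartRepresentatives (𝒢.temperedPiChart h37.toProp36Hypotheses))
    -- Prop 3.6 (iv) at `ρ_𝔾(a)` on verticial / edge-like subgroups and on (host, branch-group) pairs,
    -- Def 5.1 (i)(c) for `baseAct` (abc-iut-w4-d082's binders; design data of the outer model)
    (hV : ∀ (a : PA) (v : 𝒢.graph.Vertex) (H : Subgroup (𝒢.temperedPiChart h37.toProp36Hypotheses).G), H ∈ verticialSubgroups (𝒢.temperedPiChart h37.toProp36Hypotheses) v →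
      ∃ φ : contMulAut (𝒢.temperedPiChart h37.toProp36Hypotheses).G, TopOut.mk (𝒢.temperedPiChart h37.toProp36Hypotheses).G φ = ρ' a ∧
        H.map (φ : MulAut (𝒢.temperedPiChart h37.toProp36Hypotheses).G).toMonoidHom ∈ verticialSubgroups (𝒢.temperedPiChart h37.toProp36Hypotheses) ((baseAct a).hom.vertexMap v))
    (hE : ∀ (a : PA) (e : 𝒢.graph.Edge) (K : Subgroup (𝒢.temperedPiChart h37.toProp36Hypotheses).G), K ∈ edgeLikeSubgroups (𝒢.temperedPiChart h37.toProp36Hypotheses) e →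
      ∃ φ : contMulAut (𝒢.temperedPiChart h37.toProp36Hypotheses).G, TopOut.mk (𝒢.temperedPiChart h37.toProp36Hypotheses).G φ = ρ' a ∧
        K.map (φ : MulAut (𝒢.temperedPiChart h37.toProp36Hypotheses).G).toMonoidHom ∈ edgeLikeSubgroups (𝒢.temperedPiChart h37.toProp36Hypotheses) ((baseAct a).hom.edgeMap e))
    (hopen : ∃ U : Subgroup PA, IsOpen (U : Set PA) ∧ ∀ a ∈ U,
      (∀ v, (baseAct a).hom.vertexMap v = v) ∧ (∀ e, (baseAct a).hom.edgeMap e = e) ∧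
        ∀ b, (baseAct a).hom.branchMap b = b)
    (hBR : ∀ (a : PA) (b : 𝒢.graph.Branch) (v : 𝒢.graph.Vertex) (hb : 𝒢.graph.abuts b = some v)
      (φ : 𝒢.Gv v →ₜ* (𝒢.temperedPiChart h37.toProp36Hypotheses).G), IsVerticialHom (𝒢.temperedPiChart h37.toProp36Hypotheses) v φ →
      ∃ Φ : contMulAut (𝒢.temperedPiChart h37.toProp36Hypotheses).G, TopOut.mk (𝒢.temperedPiChart h37.toProp36Hypotheses).G Φ = ρ' a ∧
        ∃ φ' : 𝒢.Gv ((baseAct a).hom.vertexMap v) →ₜ* (𝒢.temperedPiChart h37.toProp36Hypotheses).G,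
          IsVerticialHom (𝒢.temperedPiChart h37.toProp36Hypotheses) ((baseAct a).hom.vertexMap v) φ' ∧ ∃ x' : (𝒢.temperedPiChart h37.toProp36Hypotheses).G,
            Subgroup.map (Φ : MulAut (𝒢.temperedPiChart h37.toProp36Hypotheses).G).toMonoidHom φ.toMonoidHom.range =
              Subgroup.map (MulAut.conj x').toMonoidHom φ'.toMonoidHom.range ∧
            Subgroup.map (Φ : MulAut (𝒢.temperedPiChart h37.toProp36Hypotheses).G).toMonoidHom
                (Subgroup.map φ.toMonoidHom (𝒢.branchSubgroup b v hb)) =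
              Subgroup.map (MulAut.conj x').toMonoidHom
                (Subgroup.map φ'.toMonoidHom
                  (𝒢.branchSubgroup ((baseAct a).hom.branchMap b) ((baseAct a).hom.vertexMap v)
                    ((baseAct a).hom.abuts_branchMap b v hb))))
    -- compatibility of the presentation with the outer action (producer: abc-iut-w4-d053, v2)
    (hP : ((𝒢.galoisLevelData h37.toProp36Hypotheses).piPresentation h37.toProp36Hypotheses.isCountable T R).IsArithCompatible (((contMulAut (𝒢.temperedPiChart h37.toProp36Hypotheses).G).subtype.comp (MonoidHom.fst (contMulAut (𝒢.temperedPiChart h37.toProp36Hypotheses).G) PA)).comp (outerSemidirectProduct ρ').subtype) (baseAct.comp (outerSemidirectProductSnd ρ')))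
    (w₀ : 𝒢.graph.Vertex)
    -- Φ-stability of the finite levels (abc-iut-w4-d048 (J2) / abc-iut-L3-t9)
    (hLst : ∀ (n : ℕ) (e : outerSemidirectProduct ρ') (x : (𝒢.temperedPiChart h37.toProp36Hypotheses).G), x ∈ ((𝒢.galoisLevelData h37.toProp36Hypotheses).piLevelAut h37.toProp36Hypotheses.isCountable (𝒢.galoisLevelData_hconn h37.toProp36Hypotheses) n).ker → (((contMulAut (𝒢.temperedPiChart h37.toProp36Hypotheses).G).subtype.comp (MonoidHom.fst (contMulAut (𝒢.temperedPiChart h37.toProp36Hypotheses).G) PA)).comp (outerSemidirectProduct ρ').subtype) e x ∈ ((𝒢.galoisLevelData h37.toProp36Hypotheses).piLevelAut h37.toProp36Hypotheses.isCountable (𝒢.galoisLevelData_hconn h37.toProp36Hypotheses) n).ker)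
    -- the LEVEL-B topology on `E` (abc-iut-w6-d070's `arithLevelTopology`, v2): open tree-level action kernels,
    -- tempered, abc-iut-L3-d2's neighbourhood basis, `hK1′` — all at the tree-level stability DERIVED from `hLst`
    (hKopen : ∀ n, IsOpen ((((𝒢.galoisLevelData h37.toProp36Hypotheses).piPresentation h37.toProp36Hypotheses.isCountable T R).arithAct hP ((𝒢.galoisLevelData h37.toProp36Hypotheses).projAut h37.toProp36Hypotheses.isCountable n).ker
      ((𝒢.galoisLevelData h37.toProp36Hypotheses).hKst_of_hLst_outerAction h37.toProp36Hypotheses.isCountable (𝒢.galoisLevelData_hconn h37.toProp36Hypotheses) T R ρ' hP hLst n)).ker : Set (outerSemidirectProduct ρ')))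
    (hT : IsTempered (outerSemidirectProduct ρ'))
    (hb : (𝓝 (1 : outerSemidirectProduct ρ')).HasBasis (fun _ : ℕ × OpenNormalSubgroup PA => True)
      (fun nU => ((((𝒢.galoisLevelData h37.toProp36Hypotheses).piPresentation h37.toProp36Hypotheses.isCountable T R).levelKer hP
        ((𝒢.galoisLevelData h37.toProp36Hypotheses).projAut h37.toProp36Hypotheses.isCountable nU.1).ker
        ((𝒢.galoisLevelData h37.toProp36Hypotheses).hKst_of_hLst_outerAction h37.toProp36Hypotheses.isCountable (𝒢.galoisLevelData_hconn h37.toProp36Hypotheses) T R ρ' hP hLst nU.1) ⊓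
        nU.2.toSubgroup.comap (outerSemidirectProductSnd ρ') : Subgroup (outerSemidirectProduct ρ')) :
          Set (outerSemidirectProduct ρ'))))
    (hK1' : ∀ n, IsOpen (((((𝒢.galoisLevelData h37.toProp36Hypotheses).piPresentation h37.toProp36Hypotheses.isCountable T R).levelKer hP
        ((𝒢.galoisLevelData h37.toProp36Hypotheses).projAut h37.toProp36Hypotheses.isCountable n).ker
        ((𝒢.galoisLevelData h37.toProp36Hypotheses).hKst_of_hLst_outerAction h37.toProp36Hypotheses.isCountable (𝒢.galoisLevelData_hconn h37.toProp36Hypotheses) T R ρ' hP hLst n)).map (outerSemidirectProductSnd ρ') :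
      Subgroup PA) : Set PA))
    -- Thm 5.4's printed frame hypothesis on the base
    (noSwitchBase : NoBranchSwitching 𝒢.graph.edgeOf
      (fun (a : PA) (b : 𝒢.graph.Branch) => (baseAct a).hom.branchMap b))
    -- (AI4″) at the finite levels (abc-iut-w4-d059's producer, behind `CompactOrbitLimit`, v2)
    (stabBranchPairAug : ∀ (C : Subgroup (outerSemidirectProduct ρ')),
      IsCompact (C : Set (outerSemidirectProduct ρ')) →
      ∀ (j₀ : ℕ) (w : ∀ i : {i : ℕ // j₀ ≤ i}, (((𝒢.galoisLevelData h37.toProp36Hypotheses).piPresentation h37.toProp36Hypotheses.isCountable T R).cosetGraph ((𝒢.galoisLevelData h37.toProp36Hypotheses).piLevelAut h37.toProp36Hypotheses.isCountable (𝒢.galoisLevelData_hconn h37.toProp36Hypotheses) i.1).ker).Vertex)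
      (β β' : ∀ i : {i : ℕ // j₀ ≤ i}, (((𝒢.galoisLevelData h37.toProp36Hypotheses).piPresentation h37.toProp36Hypotheses.isCountable T R).cosetGraph ((𝒢.galoisLevelData h37.toProp36Hypotheses).piLevelAut h37.toProp36Hypotheses.isCountable (𝒢.galoisLevelData_hconn h37.toProp36Hypotheses) i.1).ker).Branch),
      (∀ i, β i ≠ β' i ∧ (((𝒢.galoisLevelData h37.toProp36Hypotheses).piPresentation h37.toProp36Hypotheses.isCountable T R).cosetGraph ((𝒢.galoisLevelData h37.toProp36Hypotheses).piLevelAut h37.toProp36Hypotheses.isCountable (𝒢.galoisLevelData_hconn h37.toProp36Hypotheses) i.1).ker).abuts (β i) = some (w i) ∧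
        (((𝒢.galoisLevelData h37.toProp36Hypotheses).piPresentation h37.toProp36Hypotheses.isCountable T R).cosetGraph ((𝒢.galoisLevelData h37.toProp36Hypotheses).piLevelAut h37.toProp36Hypotheses.isCountable (𝒢.galoisLevelData_hconn h37.toProp36Hypotheses) i.1).ker).abuts (β' i) = some (w i)) →
      (∀ ⦃i i' : {i : ℕ // j₀ ≤ i}⦄ (h : i.1 ≤ i'.1),
        (((𝒢.galoisLevelData h37.toProp36Hypotheses).piPresentation h37.toProp36Hypotheses.isCountable T R).cosetGraphTrans ((𝒢.galoisLevelData h37.toProp36Hypotheses).ker_piLevelAut_anti h37.toProp36Hypotheses.isCountable (𝒢.galoisLevelData_hconn h37.toProp36Hypotheses) h)).vertexMap (w i') = w i ∧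
        (((𝒢.galoisLevelData h37.toProp36Hypotheses).piPresentation h37.toProp36Hypotheses.isCountable T R).cosetGraphTrans ((𝒢.galoisLevelData h37.toProp36Hypotheses).ker_piLevelAut_anti h37.toProp36Hypotheses.isCountable (𝒢.galoisLevelData_hconn h37.toProp36Hypotheses) h)).branchMap (β i') = β i ∧
          (((𝒢.galoisLevelData h37.toProp36Hypotheses).piPresentation h37.toProp36Hypotheses.isCountable T R).cosetGraphTrans ((𝒢.galoisLevelData h37.toProp36Hypotheses).ker_piLevelAut_anti h37.toProp36Hypotheses.isCountable (𝒢.galoisLevelData_hconn h37.toProp36Hypotheses) h)).branchMap (β' i') = β' i) →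
      (∀ (i : {i : ℕ // j₀ ≤ i}) (g : outerSemidirectProduct ρ'), g ∈ C →
        (((𝒢.galoisLevelData h37.toProp36Hypotheses).piPresentation h37.toProp36Hypotheses.isCountable T R).arithAct hP ((𝒢.galoisLevelData h37.toProp36Hypotheses).piLevelAut h37.toProp36Hypotheses.isCountable (𝒢.galoisLevelData_hconn h37.toProp36Hypotheses) i.1).ker (hLst i.1) g).hom.vertexMap (w i) = w i ∧
        (((𝒢.galoisLevelData h37.toProp36Hypotheses).piPresentation h37.toProp36Hypotheses.isCountable T R).arithAct hP ((𝒢.galoisLevelData h37.toProp36Hypotheses).piLevelAut h37.toProp36Hypotheses.isCountable (𝒢.galoisLevelData_hconn h37.toProp36Hypotheses) i.1).ker (hLst i.1) g).hom.branchMap (β i) = β i ∧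
          (((𝒢.galoisLevelData h37.toProp36Hypotheses).piPresentation h37.toProp36Hypotheses.isCountable T R).arithAct hP ((𝒢.galoisLevelData h37.toProp36Hypotheses).piLevelAut h37.toProp36Hypotheses.isCountable (𝒢.galoisLevelData_hconn h37.toProp36Hypotheses) i.1).ker (hLst i.1) g).hom.branchMap (β' i) = β' i) →
      ∃ (v : 𝒢.graph.Vertex) (b b' : 𝒢.graph.Branch) (a : PA) (h : outerSemidirectProduct ρ'),
        (decompositionDataOfChart Rc (toOuterSemidirectProduct ρ')).abut b = some v ∧ (decompositionDataOfChart Rc (toOuterSemidirectProduct ρ')).abut b' = some v ∧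
        h ∈ (decompositionDataOfChart Rc (toOuterSemidirectProduct ρ')).vertGp v ∧ (b' ≠ b ∨ h ∉ (decompositionDataOfChart Rc (toOuterSemidirectProduct ρ')).brGp b) ∧
        C.map (outerSemidirectProductSnd ρ') ≤ conjSubgroup a (((decompositionDataOfChart Rc (toOuterSemidirectProduct ρ')).brGp b ⊓
          conjSubgroup h ((decompositionDataOfChart Rc (toOuterSemidirectProduct ρ')).brGp b')).map (outerSemidirectProductSnd ρ')))
    -- Thm 5.4's own hypotheses
    (hest : IsTotallyArithEstranged (decompositionDataOfChart Rc (toOuterSemidirectProduct ρ')) (outerSemidirectProductSnd ρ')) (hbot : ¬ IsArithAmple (outerSemidirectProductSnd ρ') ⊥) :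
    ArithMaximalCompactStatementI (decompositionDataOfChart Rc (toOuterSemidirectProduct ρ')) (outerSemidirectProductSnd ρ') ∧
      ArithMaximalCompactStatementII (decompositionDataOfChart Rc (toOuterSemidirectProduct ρ')) (outerSemidirectProductSnd ρ') := by
  haveI : Finite 𝒢.graph.Edge := SemiGraph.finite_edge_of_finite_branch 𝒢.graph
  -- `hKst` from `hLst` (abc-iut-L3-t9, E1 junction)
  have hKst := (𝒢.galoisLevelData h37.toProp36Hypotheses).hKst_of_hLst_outerAction
    h37.toProp36Hypotheses.isCountable (𝒢.galoisLevelData_hconn h37.toProp36Hypotheses) T R ρ' hP hLst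
  -- the outer model: `Φ ∘ ι = conj`, `σ ∘ ι = 1` (exactness of `1 → π₁^temp → E → Π_A → 1`)
  obtain ⟨hι, hex, -⟩ := outerAction_exact (𝒢.temperedPiChart h37.toProp36Hypotheses) ρ' h37.toProp36Hypotheses
  have hιΦ : ∀ g : (𝒢.temperedPiChart h37.toProp36Hypotheses).G, (((contMulAut (𝒢.temperedPiChart h37.toProp36Hypotheses).G).subtype.comp (MonoidHom.fst (contMulAut (𝒢.temperedPiChart h37.toProp36Hypotheses).G) PA)).comp (outerSemidirectProduct ρ').subtype) ((toOuterSemidirectProduct ρ') g) = MulAut.conj g := fun _ => rfl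
  have hισ : ∀ g : (𝒢.temperedPiChart h37.toProp36Hypotheses).G, (baseAct.comp (outerSemidirectProductSnd ρ')) ((toOuterSemidirectProduct ρ') g) = 1 := fun g => by
    have hg : (toOuterSemidirectProduct ρ') g ∈ (outerSemidirectProductSnd ρ').ker := hex ▸ ⟨g, rfl⟩
    rw [MonoidHom.comp_apply, (MonoidHom.mem_ker).mp hg, map_one]
  have hPH : ∀ w, ((𝒢.galoisLevelData h37.toProp36Hypotheses).piPresentation h37.toProp36Hypotheses.isCountable T R).H w ∈ verticialSubgroups (𝒢.temperedPiChart h37.toProp36Hypotheses) w := fun w => by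
    rw [GaloisLevelData.piPresentation_H]
    exact (T w).range_decompHom_mem_verticialSubgroups
  -- `hnobpNCpt` (abc-iut-w4-d083, unconditional)
  have hnobpNCpt := hnobpNCpt_cosetTower_holds h37.toProp36Hypotheses h37
    (𝒢.galoisLevelData_hconn h37.toProp36Hypotheses) T R hP hLst (toOuterSemidirectProduct ρ') hιΦ hισ
  -- `hVE` (abc-iut-w4-d040 / abc-iut-w4-d064)
  have hVE := not_isEdgeLike_of_isVerticial_outerAction_of_finite (𝒢.temperedPiChart h37.toProp36Hypotheses)
    ρ' baseAct h37 hG Rc hV hE hopen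
  -- `hR` (abc-iut-w4-d040) at the capstones' own package (explicit form: the level families are lambdas,
  -- so their `Normal` / `Finite` instances are passed by hand, as in the capstones)
  have hR := @verticialEdgeLikeCompactAmple_outerAction_cosetTowerC 𝒢 (𝒢.temperedPiChart h37.toProp36Hypotheses)
    PA _ _ ρ' baseAct _ _ _ _ h37 hG _ _ Rc hV hE hopen hBR
    ((𝒢.galoisLevelData h37.toProp36Hypotheses).piPresentation h37.toProp36Hypotheses.isCountable T R) _ hP hιΦ hPH
    (fun ε => piPresentation_M_mem_edgeLikeSubgroups'' h37.toProp36Hypotheses T R ε) w₀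
    (fun n => ((𝒢.galoisLevelData h37.toProp36Hypotheses).projAut h37.toProp36Hypotheses.isCountable n).ker)
    (fun _ => MonoidHom.normal_ker _)
    ((𝒢.galoisLevelData h37.toProp36Hypotheses).ker_projAut_anti h37.toProp36Hypotheses.isCountable)
    hKst ((𝒢.galoisLevelData h37.toProp36Hypotheses).piPresentation_hT h37.toProp36Hypotheses.isCountable T R) hKopen noSwitchBase
    ((𝒢.galoisLevelData h37.toProp36Hypotheses).piPresentation_hHK h37.toProp36Hypotheses.isCountable T R) ((𝒢.galoisLevelData h37.toProp36Hypotheses).piPresentation_hMK h37.toProp36Hypotheses.isCountable T R)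
    ((𝒢.galoisLevelData h37.toProp36Hypotheses).piPresentation_hlift h37.toProp36Hypotheses.isCountable T R) ((𝒢.galoisLevelData h37.toProp36Hypotheses).piPresentation_hliftE h37.toProp36Hypotheses.isCountable T R)
    (fun n => ((𝒢.galoisLevelData h37.toProp36Hypotheses).piLevelAut h37.toProp36Hypotheses.isCountable (𝒢.galoisLevelData_hconn h37.toProp36Hypotheses) n).ker)
    (fun _ => MonoidHom.normal_ker _)
    (fun j => (𝒢.galoisLevelData h37.toProp36Hypotheses).finite_quotient_ker_piLevelAut h37.toProp36Hypotheses.isCountable (𝒢.galoisLevelData_hconn h37.toProp36Hypotheses)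
      (𝒢.galoisLevelData_isFinite h37.toProp36Hypotheses) j)
    ((𝒢.galoisLevelData h37.toProp36Hypotheses).ker_piLevelAut_anti h37.toProp36Hypotheses.isCountable (𝒢.galoisLevelData_hconn h37.toProp36Hypotheses)) hLst
    (fun n => (𝒢.galoisLevelData h37.toProp36Hypotheses).ker_projAut_le_ker_piLevelAut h37.toProp36Hypotheses.isCountable (𝒢.galoisLevelData_hconn h37.toProp36Hypotheses) n)
    ((𝒢.galoisLevelData h37.toProp36Hypotheses).piPresentation_hfree h37.toProp36Hypotheses.isCountable (𝒢.galoisLevelData_hconn h37.toProp36Hypotheses) T R)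
    hnobpNCpt stabBranchPairAug hT hb hK1'
    ((𝒢.galoisLevelData h37.toProp36Hypotheses).isOpen_ker_projAut h37.toProp36Hypotheses.isCountable)
  exact ⟨arithMaximalCompactStatementI_outerAction_piPresentation h37 hG ρ' baseAct T R Rc hP w₀ hKst hLst hKopen
      noSwitchBase hnobpNCpt stabBranchPairAug hest hbot,
    arithMaximalCompactStatementII_outerAction_piPresentation h37 hG ρ' baseAct T R Rc hP w₀ hKst hLst hKopen
      noSwitchBase hnobpNCpt stabBranchPairAug hest hbot hR hVE⟩

end ProfiniteSemiGraph

end Literature.AnabelianGeometry.SemiGraphs
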